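import Literature.MeasureTheory.Group.InvariantQuotientCompactSubgroup
import Literature.NumberTheory.Automorphic.LocalOrbitalIntegral
import Literature.NumberTheory.Automorphic.LocalOrbitalMeasure
import Literature.NumberTheory.Rogawski1990.TransferFactsCanonical
import Literature.NumberTheory.Automorphic.UnitaryGroupArchimedean
import Literature.NumberTheory.Automorphic.ArchWeylDiscriminant
import HarnessLib

/-!
# Orbital integrals on a COMPACT group: `O_γ(f) = t(G_γ)⁻¹ · ∫_G f(g γ g⁻¹) dν(g)`, continuous in `γ`
(Rogawski 1990, §14.5 p. 239 «compatible measures»; Lemma 14.5.2 (b), proof p. 238 «`G′_v` compact»; Folland 1995, (2.52))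

Topic `NumberTheory/Automorphic`; namespace `Literature.NumberTheory.Automorphic`.  THEOREMS ONLY (no definition, no named fact, no instance,
no notation, no `sorry`); imports ★ part (1) `MeasureTheory/Group/InvariantQuotientCompactSubgroup` (F0P3a-p08 (g11)), ★ `LocalOrbitalIntegral`
(`orbitalIntegral γ f m = ∫ y, descConj γ G_γ _ f y ∂m`), ★ `LocalOrbitalMeasure` (`isClosed_coe_centralizer_singleton`), ★
`Rogawski1990.TransferFactsCanonical` (`OrbitalMeasureFamily.IsQuotientOf`) and ★ `UnitaryGroupArchimedean` (`isCompact_arch_cm`).  Cell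
`pub/hodgecm-mathlib`, F0∕P3a, seat F0P3a-p08 (g11); LEAD DESK WORDS T6-67∕T6-68: part (2) of the brick «D1′c» — the MEASURE side of road D1′ at
the DEFINITE archimedean places — of the #88 repair census `F0/P3a/F0P3a-p05/g9/SIZING-S1prime.v2.F0P3a-p05g9.md` §2 (κ-arch) (iii)
(«definite `v` … compact group: orbital integral = continuous average, limit is evaluation») and `CENSUS-88-arch.v2` §5.

THE MATHEMATICS.  On a COMPACT (second countable Hausdorff) group `G` with Haar measure `ν`, every centraliser `G_γ` is compact, so by part (1)
the tree's orbital measure at `γ` — the invariant quotient measure `quotientMeasure G_γ t_γ ν` on `G ⧸ G_γ` for a GIVEN Haar measure `t_γ` of the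
centraliser (★ `OrbitalMeasureFamily.IsQuotientOf`, the «compatible measures» form of [Rogawski1990 §1.7 p. 6, §14.5 p. 239]) — is
`t_γ(G_γ)⁻¹ • π_* ν`.  Hence
* **`orbitalIntegral_quotientMeasure_eq_inv_smul`** — `O_γ(f) = t_γ(G_γ)⁻¹ • ∫_G f(g γ g⁻¹) dν(g)` (the centraliser mass VISIBLE: it is the one
  `γ`-dependent normalisation datum; T6-67 guardrail (i));
* **`classOrbitalIntegral_eq_of_isQuotientOf`** — the same for a family `m` with `m.IsQuotientOf P ν t`, at every `P`-class;
* **`continuous_integral_conj`** — `γ ↦ ∫_G f(g γ g⁻¹) dν(g)` is CONTINUOUS ON ALL OF `G` for continuous `f` (Mathlib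
  `continuous_parametric_integral_of_continuous`; no regularity, no singular set): at a definite place the un-normalised orbital integral has
  a LIMIT at every singular `γ₀`, equal to its VALUE there («`lim_{γ′→γ} D_G(γ′)Φ(γ′, f′_v) = 0` since `G′_v` is compact», p. 238);
* `integral_conj_of_mem_center` — at a central `γ` the average is `ν(G) • f(γ)` («limit is evaluation»);
* last §: the `arch` specialisation — `UnitaryGroup.compactSpace_arch_cm` (★ `isCompact_arch_cm` as a `CompactSpace` statement, a THEOREM used by
  `haveI`) and **`UnitaryGroup.continuous_integral_conj_arch`** at a TOTALLY DEFINITE hermitian `H`.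
* §4 (ED. 2, LEAD T6-81 «B2»): with F0P3a-p02 (g8)'s ★ `archWeylDiscr` — **`UnitaryGroup.continuous_archWeylDiscr_rpow_smul_integral_conj_arch`**,
  **`UnitaryGroup.exists_bound_archWeylDiscr_rpow_smul_integral_conj_arch`** («`|D|^{1∕2} Φ_γ(f)` is bounded on the compact factor») and the
  orbital-integral dress **`UnitaryGroup.exists_bound_archWeylDiscr_rpow_smul_orbitalIntegral_arch`** with the centraliser masses `t_γ(G_γ) ≥ m > 0`
  EXPLICIT.
HONEST LABEL: HC_CM is proved only modulo the printed citations until rung 0 closes; count-neutral floor-1 prep of D1′ (the indefinite places —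
D2′ limit formula, D3′ descent — remain print); no stub closes.

## References
* [Rogawski1990] J. D. Rogawski, *Automorphic Representations of Unitary Groups in Three Variables* (1990), §1.7 p. 6, §14.5 p. 239, Lemma 14.5.2 (b)
  proof p. 238, §12.3.
* [Shelstad1979] D. Shelstad, *Characters and inner forms of a quasi-split group over `ℝ`*, Compositio Math. 39 (1979), §4.
* [Folland1995] G. B. Folland, *A Course in Abstract Harmonic Analysis* (1995), §2.6 Thm. 2.49, (2.52).
-/

set_option autoImplicit false

noncomputable section

open _root_.MeasureTheory _root_.MeasureTheory.Measure _root_.Topology Set Filter Function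
open scoped ENNReal NNReal
open Literature.MeasureTheory.Group

namespace Literature.NumberTheory.Automorphic

/-! ## §1 The conjugation average `γ ↦ ∫_G f(g γ g⁻¹) dν` on a compact group -/

section Average

variable {G : Type*} [Group G] [TopologicalSpace G] [IsTopologicalGroup G] [CompactSpace G] [LocallyCompactSpace G]
  [SecondCountableTopology G] [T2Space G] [MeasurableSpace G] [BorelSpace G] (ν : Measure G) [IsFiniteMeasureOnCompacts ν]
  {E : Type*} [NormedAddCommGroup E] [NormedSpace ℝ E]

/-- **`γ ↦ ∫_G f(g γ g⁻¹) dν(g)` IS CONTINUOUS ON ALL OF THE COMPACT GROUP `G`** for continuous `f` (a parametric integral of a jointly continuous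
integrand over a compact space, Mathlib `continuous_parametric_integral_of_continuous`): at a definite place the un-normalised orbital integral is
continuous through every singular element. [cite: Rogawski1990, §14.5 Lemma 14.5.2 (b) proof p. 238] [cite: Shelstad1979, §4] -/
theorem continuous_integral_conj (f : G → E) (hf : Continuous f) : Continuous fun γ : G => ∫ g, f (g * γ * g⁻¹) ∂ν := by
  have h2 : Continuous (fun p : G × G => f (p.2 * p.1 * p.2⁻¹)) :=
    hf.comp ((continuous_snd.mul continuous_fst).mul continuous_snd.inv)
  have h := continuous_parametric_integral_of_continuous (μ := ν) (f := fun γ g => f (g * γ * g⁻¹)) h2 isCompact_univ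
  simpa only [Measure.restrict_univ] using h

omit [TopologicalSpace G] [IsTopologicalGroup G] [CompactSpace G] [LocallyCompactSpace G] [SecondCountableTopology G] [T2Space G]
  [BorelSpace G] [IsFiniteMeasureOnCompacts ν] in
/-- **At a central `γ` the conjugation average is `ν(G) • f(γ)`** («limit is evaluation»). [cite: Rogawski1990, §14.5 p. 239] -/
theorem integral_conj_of_mem_center [CompleteSpace E] (f : G → E) {γ : G} (hγ : γ ∈ Subgroup.center G) :
    ∫ g, f (g * γ * g⁻¹) ∂ν = ν.real Set.univ • f γ := by
  have h1 : (fun g : G => f (g * γ * g⁻¹)) = fun _ => f γ := by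
    funext g
    rw [Subgroup.mem_center_iff.1 hγ g, mul_inv_cancel_right]
  rw [h1, integral_const]

end Average

/-! ## §2 Orbital integrals against the quotient measure of a compact centraliser -/

section Orbital

variable {G : Type*} [Group G] [TopologicalSpace G] [IsTopologicalGroup G] [CompactSpace G] [LocallyCompactSpace G]
  [SecondCountableTopology G] [T2Space G] [MeasurableSpace G] [BorelSpace G]
  [∀ γ : G, MeasurableSpace (G ⧸ Subgroup.centralizer ({γ} : Set G))]
  [∀ γ : G, BorelSpace (G ⧸ Subgroup.centralizer ({γ} : Set G))]
  (ν : Measure G) [IsHaarMeasure ν] [ν.IsMulRightInvariant]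
  {E : Type*} [NormedAddCommGroup E] [NormedSpace ℝ E]

omit [LocallyCompactSpace G] [SecondCountableTopology G] [MeasurableSpace G] [BorelSpace G]
  [∀ γ : G, MeasurableSpace (G ⧸ Subgroup.centralizer ({γ} : Set G))] [∀ γ : G, BorelSpace (G ⧸ Subgroup.centralizer ({γ} : Set G))] in
/-- The centraliser of an element of a compact Hausdorff group is compact (it is closed). [folklore] -/
private theorem compactSpace_centralizer (γ : G) : CompactSpace ↥(Subgroup.centralizer ({γ} : Set G)) :=
  isCompact_iff_compactSpace.1 (isClosed_coe_centralizer_singleton γ).isCompact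

omit [CompactSpace G] [LocallyCompactSpace G] [SecondCountableTopology G] [T2Space G] [MeasurableSpace G] [BorelSpace G]
  [∀ γ : G, MeasurableSpace (G ⧸ Subgroup.centralizer ({γ} : Set G))] [∀ γ : G, BorelSpace (G ⧸ Subgroup.centralizer ({γ} : Set G))]
  [NormedSpace ℝ E] in
/-- The orbital integrand `y G_γ ↦ f(y γ y⁻¹)` (★ `descConj`) is continuous on `G ⧸ G_γ` for continuous `f`. [folklore] -/
private theorem continuous_descConj_centralizer (γ : G) (f : G → E) (hf : Continuous f) :
    Continuous (descConj γ (Subgroup.centralizer ({γ} : Set G)) (fun _ hg => Subgroup.mem_centralizer_singleton_iff.1 hg) f) := by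
  rw [(QuotientGroup.isQuotientMap_mk (Subgroup.centralizer ({γ} : Set G))).continuous_iff, descConj_comp_mk]
  exact hf.comp ((continuous_id.mul continuous_const).mul continuous_id.inv)

/-- **`O_γ(f) = t(G_γ)⁻¹ • ∫_G f(g γ g⁻¹) dν(g)` ON A COMPACT GROUP**: the orbital integral of a continuous `f` at `γ` against the invariant
quotient measure of the Haar measure `ν` by a GIVEN Haar measure `t` of the (compact) centraliser `G_γ` (★ `orbitalIntegral`, ★ `quotientMeasure`)
is the conjugation average of `f`, normalised by the VISIBLE centraliser mass `t(G_γ)` — the «compatible measures» datum of print.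
[cite: Rogawski1990, §1.7 p. 6; §14.5 p. 239] [cite: Folland1995, §2.6 (2.52)] -/
theorem orbitalIntegral_quotientMeasure_eq_inv_smul (γ : G) (t : Measure ↥(Subgroup.centralizer ({γ} : Set G))) [t.IsHaarMeasure]
    [t.IsInvInvariant] (f : G → E) (hf : Continuous f) :
    orbitalIntegral γ f (quotientMeasure (Subgroup.centralizer ({γ} : Set G)) t (isClosed_coe_centralizer_singleton γ) ν) =
      (t.real Set.univ)⁻¹ • ∫ g, f (g * γ * g⁻¹) ∂ν := by
  haveI := compactSpace_centralizer (G := G) γ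
  haveI : IsClosed ((Subgroup.centralizer ({γ} : Set G)) : Set G) := isClosed_coe_centralizer_singleton γ
  rw [orbitalIntegral_eq_integral_descConj,
    integral_quotientMeasure_eq_inv_smul (Subgroup.centralizer ({γ} : Set G)) t ν _
      (continuous_descConj_centralizer γ f hf).stronglyMeasurable]
  rfl

/-- **The same for an orbital-measure family of the WEIL FORM** ★ `OrbitalMeasureFamily.IsQuotientOf P ν t m`: at every `P`-class `c`,
`classOrbitalIntegral m f c = t(G_{γ_c})⁻¹ • ∫_G f(g γ_c g⁻¹) dν(g)`, `γ_c = out c`. [cite: Rogawski1990, §4.3 (4.3.1) p. 43; §14.5 p. 239] -/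
theorem classOrbitalIntegral_eq_of_isQuotientOf {P : G → Prop} {t : ∀ γ : G, Measure ↥(Subgroup.centralizer ({γ} : Set G))}
    {m : OrbitalMeasureFamily G} (h : m.IsQuotientOf P ν t) (c : ConjClasses G) (hc : P (Quotient.out c)) (f : G → E) (hf : Continuous f) :
    classOrbitalIntegral m f c = ((t (Quotient.out c)).real Set.univ)⁻¹ • ∫ g, f (g * Quotient.out c * g⁻¹) ∂ν := by
  obtain ⟨hHaar, hInv, hmc⟩ := h c hc
  rw [classOrbitalIntegral_eq, hmc]
  exact orbitalIntegral_quotientMeasure_eq_inv_smul ν (Quotient.out c) (t (Quotient.out c)) f hf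

/-- **Continuity of the Weil-form orbital integrals up to the centraliser mass**: on a compact group, for continuous `f`,
`γ ↦ t(G_γ) • O_γ(f)` is the restriction of the CONTINUOUS function `γ ↦ ∫_G f(g γ g⁻¹) dν` — the `γ`-dependence left in `O_γ(f)` itself is the
normalisation `t(G_γ)` alone (where compatibility of measures ∕ (S-d) enter). [cite: Rogawski1990, §14.5 p. 239; L. 14.5.2 (b) proof p. 238] [cite: Shelstad1979, §4] -/
theorem measureReal_univ_smul_orbitalIntegral_quotientMeasure (γ : G) (t : Measure ↥(Subgroup.centralizer ({γ} : Set G))) [t.IsHaarMeasure]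
    [t.IsInvInvariant] (f : G → E) (hf : Continuous f) :
    (t.real Set.univ) • orbitalIntegral γ f (quotientMeasure (Subgroup.centralizer ({γ} : Set G)) t (isClosed_coe_centralizer_singleton γ) ν) =
      ∫ g, f (g * γ * g⁻¹) ∂ν := by
  haveI := compactSpace_centralizer (G := G) γ
  have h0 : t.real Set.univ ≠ 0 :=
    (ENNReal.toReal_pos (isOpen_univ.measure_pos t univ_nonempty).ne' isCompact_univ.measure_lt_top.ne).ne'
  rw [orbitalIntegral_quotientMeasure_eq_inv_smul ν γ t f hf, smul_smul, mul_inv_cancel₀ h0, one_smul]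

end Orbital

/-! ## §3 Dock: the archimedean unitary group of a totally definite hermitian form -/

section Arch

open _root_.NumberField
open scoped ComplexOrder

variable (L : Type) [Field L] [NumberField L] [IsCMField L] {N : ℕ} (H : Matrix (Fin N) (Fin N) L)

/-- **`U(H)(L⁺ ⊗ ℝ)` is a compact SPACE for a totally definite `H`** (★ `UnitaryGroup.isCompact_arch_cm`, restated on the subtype; a THEOREM to be
used with `haveI`, not an instance). [cite: PlatonovRapinchuk1994, §3.2 Thm 3.1] [cite: Rogawski1990, §14.5 p. 238] -/
theorem UnitaryGroup.compactSpace_arch_cm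
    (hdef : ∀ w : {w : InfinitePlace L // InfinitePlace.IsComplex w}, (H.map w.1.embedding).PosDef ∨ (-H.map w.1.embedding).PosDef) :
    CompactSpace ↥(UnitaryGroup.arch (↥(maximalRealSubfield L)) L (IsCMField.complexConj L) N H) :=
  isCompact_iff_compactSpace.1 (UnitaryGroup.isCompact_arch_cm (N := N) (L := L) (H := H) hdef)

/-- **At a TOTALLY DEFINITE place the un-normalised orbital integral is continuous in `γ` on all of `U(H)(L⁺ ⊗ ℝ)`**: for any Borel measure `ν`
finite on compacts on the compact group `G′_∞ = U(H)(L⁺ ⊗ ℝ)` and continuous `f`, `γ ↦ ∫ f(g γ g⁻¹) dν(g)` is continuous (§1 at the dock of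
★ `isCompact_arch_cm`). [cite: Rogawski1990, §14.5 Lemma 14.5.2 (b) proof p. 238] [cite: Shelstad1979, §4] -/
theorem UnitaryGroup.continuous_integral_conj_arch
    (hdef : ∀ w : {w : InfinitePlace L // InfinitePlace.IsComplex w}, (H.map w.1.embedding).PosDef ∨ (-H.map w.1.embedding).PosDef)
    [MeasurableSpace ↥(UnitaryGroup.arch (↥(maximalRealSubfield L)) L (IsCMField.complexConj L) N H)]
    [BorelSpace ↥(UnitaryGroup.arch (↥(maximalRealSubfield L)) L (IsCMField.complexConj L) N H)]
    (ν : Measure ↥(UnitaryGroup.arch (↥(maximalRealSubfield L)) L (IsCMField.complexConj L) N H)) [IsFiniteMeasureOnCompacts ν]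
    {E : Type*} [NormedAddCommGroup E] [NormedSpace ℝ E]
    (f : ↥(UnitaryGroup.arch (↥(maximalRealSubfield L)) L (IsCMField.complexConj L) N H) → E) (hf : Continuous f) :
    Continuous fun γ : ↥(UnitaryGroup.arch (↥(maximalRealSubfield L)) L (IsCMField.complexConj L) N H) => ∫ g, f (g * γ * g⁻¹) ∂ν := by
  haveI := UnitaryGroup.compactSpace_arch_cm L H hdef
  have h2 : Continuous (fun p : ↥(UnitaryGroup.arch (↥(maximalRealSubfield L)) L (IsCMField.complexConj L) N H) ×
      ↥(UnitaryGroup.arch (↥(maximalRealSubfield L)) L (IsCMField.complexConj L) N H) => f (p.2 * p.1 * p.2⁻¹)) :=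
    hf.comp ((continuous_snd.mul continuous_fst).mul continuous_snd.inv)
  have h := continuous_parametric_integral_of_continuous (μ := ν) (f := fun γ g => f (g * γ * g⁻¹)) h2 isCompact_univ
  simpa only [Measure.restrict_univ] using h

end Arch

/-! ## §4 (ED. 2) `|D(γ)|^{1∕2}`-weighted orbital integrals on the compact factor are continuous and BOUNDED
(Rogawski 1990, §14.5 p. 239; Shelstad 1979, §4: «`|D|^{1∕2} Φ_γ(f)` is bounded on the compact factor») -/

section WeylWeighted

open _root_.NumberField
open scoped ComplexOrder

variable (L : Type) [Field L] [NumberField L] [IsCMField L] {N : ℕ} (H : Matrix (Fin N) (Fin N) L)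
  (hdef : ∀ w : {w : InfinitePlace L // InfinitePlace.IsComplex w}, (H.map w.1.embedding).PosDef ∨ (-H.map w.1.embedding).PosDef)
  [MeasurableSpace ↥(UnitaryGroup.arch (↥(maximalRealSubfield L)) L (IsCMField.complexConj L) N H)]
  [BorelSpace ↥(UnitaryGroup.arch (↥(maximalRealSubfield L)) L (IsCMField.complexConj L) N H)]
  (ν : Measure ↥(UnitaryGroup.arch (↥(maximalRealSubfield L)) L (IsCMField.complexConj L) N H)) [IsFiniteMeasureOnCompacts ν]
  {E : Type*} [NormedAddCommGroup E] [NormedSpace ℝ E]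

include hdef

/-- **`γ ↦ |D(γ)|_∞^{1∕2} · ∫ f(g γ g⁻¹) dν(g)` IS CONTINUOUS on the compact real group `U(H)(L⁺ ⊗ ℝ)`** (`H` totally definite): ★
`UnitaryGroup.continuous_archWeylDiscr_arch` (F0P3a-p02 (g8)) times ★ `continuous_integral_conj_arch`. [cite: Rogawski1990, §14.5 p. 239] [cite: Shelstad1979, §4] -/
theorem UnitaryGroup.continuous_archWeylDiscr_rpow_smul_integral_conj_arch
    (f : ↥(UnitaryGroup.arch (↥(maximalRealSubfield L)) L (IsCMField.complexConj L) N H) → E) (hf : Continuous f) :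
    Continuous fun γ : ↥(UnitaryGroup.arch (↥(maximalRealSubfield L)) L (IsCMField.complexConj L) N H) =>
      (archWeylDiscr ((γ : GL (Fin N) (mixedEmbedding.mixedSpace L)) : Matrix (Fin N) (Fin N) (mixedEmbedding.mixedSpace L))) ^ (1 / 2 : ℝ) •
        ∫ g, f (g * γ * g⁻¹) ∂ν :=
  ((UnitaryGroup.continuous_archWeylDiscr_arch (↥(maximalRealSubfield L)) (IsCMField.complexConj L) H).rpow_const
      fun γ => Or.inr (by norm_num)).smul
    (UnitaryGroup.continuous_integral_conj_arch L H hdef ν f hf)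

/-- **`|D(γ)|_∞^{1∕2} · ∫ f(g γ g⁻¹) dν(g)` IS BOUNDED on `U(H)(L⁺ ⊗ ℝ)`** (`H` totally definite: the group is compact, ★ `compactSpace_arch_cm`, and the
function is continuous) — print's «`|D|^{1∕2} Φ_γ(f)` is bounded» at a compact real place, in the tree's un-normalised currency.
[cite: Rogawski1990, §14.5 p. 239] [cite: Shelstad1979, §4] -/
theorem UnitaryGroup.exists_bound_archWeylDiscr_rpow_smul_integral_conj_arch
    (f : ↥(UnitaryGroup.arch (↥(maximalRealSubfield L)) L (IsCMField.complexConj L) N H) → E) (hf : Continuous f) :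
    ∃ C : ℝ, ∀ γ : ↥(UnitaryGroup.arch (↥(maximalRealSubfield L)) L (IsCMField.complexConj L) N H),
      ‖(archWeylDiscr ((γ : GL (Fin N) (mixedEmbedding.mixedSpace L)) : Matrix (Fin N) (Fin N) (mixedEmbedding.mixedSpace L))) ^ (1 / 2 : ℝ) •
        ∫ g, f (g * γ * g⁻¹) ∂ν‖ ≤ C := by
  haveI := UnitaryGroup.compactSpace_arch_cm L H hdef
  obtain ⟨C, hC⟩ := isCompact_univ.exists_bound_of_continuousOn
    (UnitaryGroup.continuous_archWeylDiscr_rpow_smul_integral_conj_arch L H hdef ν f hf).continuousOn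
  exact ⟨C, fun γ => hC γ (Set.mem_univ γ)⟩

end WeylWeighted

section WeylWeightedOrbital

open _root_.NumberField
open scoped ComplexOrder

variable (L : Type) [Field L] [NumberField L] [IsCMField L] {N : ℕ} (H : Matrix (Fin N) (Fin N) L)
  (hdef : ∀ w : {w : InfinitePlace L // InfinitePlace.IsComplex w}, (H.map w.1.embedding).PosDef ∨ (-H.map w.1.embedding).PosDef)
  [MeasurableSpace ↥(UnitaryGroup.arch (↥(maximalRealSubfield L)) L (IsCMField.complexConj L) N H)]
  [BorelSpace ↥(UnitaryGroup.arch (↥(maximalRealSubfield L)) L (IsCMField.complexConj L) N H)]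
  [∀ γ : ↥(UnitaryGroup.arch (↥(maximalRealSubfield L)) L (IsCMField.complexConj L) N H),
    MeasurableSpace (↥(UnitaryGroup.arch (↥(maximalRealSubfield L)) L (IsCMField.complexConj L) N H) ⧸ Subgroup.centralizer {γ})]
  [∀ γ : ↥(UnitaryGroup.arch (↥(maximalRealSubfield L)) L (IsCMField.complexConj L) N H),
    BorelSpace (↥(UnitaryGroup.arch (↥(maximalRealSubfield L)) L (IsCMField.complexConj L) N H) ⧸ Subgroup.centralizer {γ})]
  (ν : Measure ↥(UnitaryGroup.arch (↥(maximalRealSubfield L)) L (IsCMField.complexConj L) N H)) [IsHaarMeasure ν] [ν.IsMulRightInvariant]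
  {E : Type*} [NormedAddCommGroup E] [NormedSpace ℝ E]

include hdef

/-- **The orbital-integral dress, WITH the centraliser mass explicit**: for continuous `f`, a GIVEN family of Haar measures `t γ` on the
centralisers, and a set `S` of elements whose centraliser masses are bounded below (`m ≤ t_γ(G_γ)`, `0 < m`), the `|D|^{1∕2}`-weighted Weil-form
orbital integrals `|D(γ)|^{1∕2} · O_γ(f)` (★ `orbitalIntegral` against ★ `quotientMeasure G_γ (t γ) ν`) are BOUNDED on `S`: `|D|^{1∕2} O_γ(f) =
t_γ(G_γ)⁻¹ · (|D|^{1∕2} ∫ f(gγg⁻¹) dν)` (★ `orbitalIntegral_quotientMeasure_eq_inv_smul`).  The mass `t_γ(G_γ)` is NOT hidden: it is the «compatible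
measures» ∕ (S-d) datum, and the bound is uniform exactly where it is bounded below. [cite: Rogawski1990, §1.7 p. 6; §14.5 p. 239] [cite: Shelstad1979, §4] -/
theorem UnitaryGroup.exists_bound_archWeylDiscr_rpow_smul_orbitalIntegral_arch
    (f : ↥(UnitaryGroup.arch (↥(maximalRealSubfield L)) L (IsCMField.complexConj L) N H) → E) (hf : Continuous f)
    (t : ∀ γ : ↥(UnitaryGroup.arch (↥(maximalRealSubfield L)) L (IsCMField.complexConj L) N H), Measure ↥(Subgroup.centralizer {γ}))
    (ht : ∀ γ, (t γ).IsHaarMeasure) (ht' : ∀ γ, (t γ).IsInvInvariant)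
    {S : Set ↥(UnitaryGroup.arch (↥(maximalRealSubfield L)) L (IsCMField.complexConj L) N H)} {m : ℝ} (hm : 0 < m)
    (hS : ∀ γ ∈ S, m ≤ (t γ).real Set.univ) :
    ∃ C : ℝ, ∀ γ ∈ S,
      ‖(archWeylDiscr ((γ : GL (Fin N) (mixedEmbedding.mixedSpace L)) : Matrix (Fin N) (Fin N) (mixedEmbedding.mixedSpace L))) ^ (1 / 2 : ℝ) •
        orbitalIntegral γ f (quotientMeasure (Subgroup.centralizer {γ}) (t γ) (isClosed_coe_centralizer_singleton γ) ν)‖ ≤ C := by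
  haveI := UnitaryGroup.compactSpace_arch_cm L H hdef
  obtain ⟨C, hC⟩ := UnitaryGroup.exists_bound_archWeylDiscr_rpow_smul_integral_conj_arch L H hdef ν f hf
  have hC0 : 0 ≤ C := (norm_nonneg _).trans (hC 1)
  refine ⟨m⁻¹ * C, fun γ hγ => ?_⟩
  haveI := ht γ
  haveI := ht' γ
  have hmass : 0 < (t γ).real Set.univ := hm.trans_le (hS γ hγ)
  rw [orbitalIntegral_quotientMeasure_eq_inv_smul ν γ (t γ) f hf, smul_comm, norm_smul, norm_inv, Real.norm_of_nonneg hmass.le]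
  exact mul_le_mul (inv_anti₀ hm (hS γ hγ)) (hC γ) (norm_nonneg _) (inv_nonneg.2 hm.le)

end WeylWeightedOrbital

end Literature.NumberTheory.Automorphic

end
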